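/-
Origin: expansion seat `prover-pub-hodgecm-mc-binder-2-g11-0`, handover #26 r3 2026-08-20T02:48Z md5 4fca6cc5a78d (219 l.; CERTIFIED rc 0 / 0 warn / 48.2 s; SUPERSEDES r2 c710807b2a2a (RUN-38 CERT #1 `:75:8 (kernel) deterministic timeout`): §1 `fst_cmBlockSectionAt_one_left` re-proved WITHOUT the kernel `rfl` through the pin — via the tree's `Ginf.relabel_apply`, `archPairFrame_archPairFrameEquiv_symm`, `archPairFrame_apply_eq_toUForm`, `toUForm_bijective`, `archPairSection_apply`, `archPairSingle_apply` (all componentwise); + `import HodgeCM.Automorphic.AdelicTorusThetaData` (for `S.gramW`), qualified `UnitaryGroup.complexConj_smul_infinitePlace` / `Adelic.adelicUnitaryGroup`, `include hηc in`, `boostCurveW V S v …` (ι₁ implicit), two `rfl`/`map_one` endings; statements of §2/§3 unchanged: `boostCurveW`, `boostCurveW_zero`, **`pair_cmAdelicEquiv_boostCurveW`**, `dW_signs_of_ne`, **`tendsto_toThetaTop_boostCurveW_sub_div`**; axioms trio) (`HOME/mc/pub-hodgecm-mc-binder-2/g11/pkg/HodgeCM/Model/HypCensus/SmoothW.lean`,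 md5 4fca6cc5a78d, 219 lines);
landed by the gen-14 packager (p-g14) in gate run 39 as `HodgeCM/Model/HypCensus/SmoothW.lean` (verbatim).
-/
/-
Origin: speedrun cell pub-hodgecm, MODEL-CONSTRUCTION sub-cell, lineage mc-binder-2 (BINDER-OWNERS rows 18/19: E binders
`hyp12` / `hyp34` of `Model.perL_picardCM_r15A`), seat prover-pub-hodgecm-mc-binder-2-g8-0 (gen 8) / r2 prover-pub-hodgecm-mc-binder-2-g10-0 (gen 10: VALUE currency per model1 (R2),
no `wm`-record in any statement), 2026-08-19; r3 prover-pub-hodgecm-mc-binder-2-g11-0 (gen 11, 2026-08-20: §1 `fst_cmBlockSectionAt_one_left` re-proved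
WITHOUT the kernel `rfl` that timed out at RUN-38 CERT #1 — statements unchanged).
Target in PKG: `HodgeCM/Model/HypCensus/SmoothW.lean` (NEW additive leaf; imports this kit's `HypCensus/SmoothTwist` and mc-unitary-1's
`Model/WmInstanceV2` (both RUN 36 INSTALLED); nothing landed imports it).
KERNEL ONLY: 0 records, nothing cited, 0 `def … : Prop`; one data def (`boostCurveW`) + theorems.
-/
import Summits.HodgeConjecture.HodgeCM.Model.HypCensus.SmoothTwist
import Summits.HodgeConjecture.HodgeCM.Model.WmInstanceV2
import Summits.HodgeConjecture.HodgeCM.Automorphic.AdelicTorusThetaData_2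

/-!
# Census kit (rows A12/A34), junction (J-smooth): the boost curve in `U(W)(𝔸)` and the `Θ`-topology slope, VALUE currency

`HypCensus/SideW` states the census field `smooth` on a `wm` input `W₀`:
`s⁻¹ • (W₀.ρ (1, W₀.eW (e b u s)) (ins f φ) − ins f φ) ⟶ ins f (H^{(b)} φ)` in Weil's `ThetaTop`, the curve `e b u` running in
`U(W)(𝔸) = adelicUnitaryGroup L S.gramW`.  For the W pin of record (`wmInputCM₂g`, mc-unitary-1 `Model/WmInputInstance`, RUN 37;
model1 (R1″)) `W₀.eW = cmAdelicEquiv L 2 (diag (dW S))` definitionally and `W₀.ρ = (cmPairRepTwist … hGR η).toHomUnits` under the sign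
fact `hW` (`wmInputCM₂g_ρ_eq_of`).  This leaf supplies the (J-smooth) headline of the kit (`SmoothTwist`, over `SmoothTheta` /
`SmoothBlock` / the tree's Folland–Konno–Konno junction) IN THAT VALUE CURRENCY — no `wm` record occurs in any statement (model1 (R2)),
the twist character `η` is generic ((R3)):

* §1 `fst_cmBlockSectionAt_one_left` / `archProdHom_cmBlockSectionAt_one_left` — the block section of `(1, y)` has trivial
  `V`-component, so `archProdHom (s_v (1, y)) = (1, (s_v (1, y)).2_𝔸)`;
* §2 **`boostCurveW v … r₀ s₀ : ℝ → U(W)(𝔸)`**, `t ↦ (cmAdelicEquiv …)⁻¹ ((s_v (1, a_t)).2_𝔸)` (the field `e` at a `Σ₁₂` place),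
  `boostCurveW_zero` (field `e_zero`), **`pair_cmAdelicEquiv_boostCurveW`**: `(1, cmAdelicEquiv … (boostCurveW t)) = archProdHom (s_v (1, a_t))`;
  `dW_signs_of_ne` (the `W`-side sign profile off `ι₁` HOLDS for `M = 2`, tree `signs_fin_two`);
* §3 **`tendsto_toThetaTop_boostCurveW_sub_div`** — for every rational set `Γ`, every block pure tensor `Ψ = F_v⁻¹(Φ₁ ⊠ Φ₂)` and finite
  datum `f`: `s⁻¹ • (ρ_η(1, cmAdelicEquiv (boostCurveW s)) E(Ψ ⊗ f) − E(Ψ ⊗ f)) ⟶ E(F_v⁻¹((hypOpWGen Φ₁) ⊠ Φ₂) ⊗ f)` in the `Θ`-initial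
  topology of `repWeilThetaDatum L⁺ (Fin 6) ρ_η.toHomUnits Γ`, `ρ_η = cmPairRepTwist … hGR η`.  Hypotheses: the slot's small datum
  `hW₁ hc₁` (rows #8/#11), `h₁W` (`W` definite at `ι₁`, from `GoodCtx`) and `hηc` (continuity of `η`); Weil's pair majorants are
  DISCHARGED from `h₁W` + the `HermSpace3` sign facts (vendored `hasThetaMajorants_cmPairSplitting_of_signs_two`, as in mc-unitary-1's
  `hρ_of_dW_definite`), the `V`-side sign facts READ OFF `HermSpace3` (`frameD_sign_ι₁'`, `frameD_sign_of_ne`).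

The dictionary step `F_v⁻¹((hypOpWGen Φ₁) ⊠ Φ₂) = ins (hypX ⟨b,u⟩ φ)` and the extension to all printed vectors are `HypCensus/Ins` (#27)
and `HypCensus/SmoothIns` (#28).  Nothing here is a claim of PerL/QW8.
-/

set_option autoImplicit false

noncomputable section

open Filter Topology
open NumberField NumberField.InfinitePlace IsDedekindDomain MeasureTheory
open scoped Matrix
open scoped Kronecker Classical TensorProduct ComplexConjugate
open Literature.NumberTheory.Automorphic Literature.NumberTheory.Automorphic.UnitaryGroup Literature.NumberTheory.Weil1964
open Literature.RepresentationTheory.HeisenbergGroup (polar Heisenberg symplecticGroup ofSymplectic)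
open Literature.RepresentationTheory.KonnoKonno2007 Literature.RepresentationTheory.KonnoKonno2007.RealDualPair
open Literature.NumberTheory.GelbartRogawski1991 Literature.NumberTheory.GelbartRogawski1991.UnitaryDualPair
open Literature.Analysis.SegalBargmann Literature.Analysis.Distribution
open HodgeCM HodgeCM.Model HodgeCM.Adelic

namespace HodgeCM.Model.HypCensus

/-! ## §1 The block section of `(1, y)` has trivial `V`-component -/

section Section

variable (L : Type) [Field L] [NumberField L] [IsCMField L] {N M n : ℕ} (e : Fin N × Fin M ≃ Fin n)
variable (dV : Fin N → L) (hdV : ∀ i, IsCMField.complexConj L (dV i) = dV i) (hdV0 : ∀ i, dV i ≠ 0)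
variable (dW : Fin M → L) (hdW : ∀ i, IsCMField.complexConj L (dW i) = dW i) (hdW0 : ∀ i, dW i ≠ 0)
variable (ι₁ : L →+* ℂ) (v : {v : InfinitePlace ↥(maximalRealSubfield L) // v.IsReal})
variable {P' Q' R' S' : Type} [Fintype P'] [DecidableEq P'] [Fintype Q'] [DecidableEq Q'] [Fintype R'] [DecidableEq R']
  [Fintype S'] [DecidableEq S']
variable (eP : PosIdx (cmXV L dV hdV ι₁ v) ≃ P') (eQ : NegIdx (cmXV L dV hdV ι₁ v) ≃ Q')
  (eR : PosIdx (cmXW L dV dW hdW ι₁ v) ≃ R') (eS : NegIdx (cmXW L dV dW hdW ι₁ v) ≃ S')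

/-- **the block section of a `W`-only element has trivial `V`-component**: `(s_v (1, y)).1 = 1` (the section is the product of the
`V`-side and `W`-side place sections, so its first component only sees the first component of the argument). -/
theorem fst_cmBlockSectionAt_one_left (y : UForm R' S') :
    (cmBlockSectionAt L dV hdV hdV0 dW hdW hdW0 ι₁ v eP eQ eR eS (((1 : UForm P' Q'), y) : Ginf P' Q' R' S')).1 = 1 := by
  -- r3 (binder-2-g11): NO kernel `rfl` through the pin (RUN-38 CERT #1: `(kernel) deterministic timeout` at the former `rfl`);
  -- the three maps `Ginf.relabel⁻¹`, `archPairFrameEquiv⁻¹`, `archPairSingle` are componentwise, read through their `apply` lemmas.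
  set g' := (Ginf.relabel (PosIdx (cmXV L dV hdV ι₁ v)) (NegIdx (cmXV L dV hdV ι₁ v)) (PosIdx (cmXW L dV dW hdW ι₁ v))
      (NegIdx (cmXW L dV dW hdW ι₁ v)) P' Q' R' S' eP eQ eR eS).symm (((1 : UForm P' Q'), y) : Ginf P' Q' R' S') with hg'
  have hR := (Ginf.relabel (PosIdx (cmXV L dV hdV ι₁ v)) (NegIdx (cmXV L dV hdV ι₁ v)) (PosIdx (cmXW L dV dW hdW ι₁ v))
      (NegIdx (cmXW L dV dW hdW ι₁ v)) P' Q' R' S' eP eQ eR eS).apply_symm_apply (((1 : UForm P' Q'), y) : Ginf P' Q' R' S')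
  rw [← hg', Ginf.relabel_apply] at hR
  have h1 : g'.1 = 1 :=
    (UForm.relabel _ _ _ _ eP eQ).injective (((Prod.ext_iff.1 hR).1).trans (map_one (UForm.relabel _ _ _ _ eP eQ)).symm)
  have hE := archPairFrame_archPairFrameEquiv_symm L (IsCMField.complexConj L) N M (IsCMField.complexConj_ne_one L)
    (cmPlaceOver L) (cmPlaceOver_smul L) (cmPlaceOver_comap L) (cmRealVec L dV hdV) (cmRealVec L dW hdW)
    (realDiagonal_map L dV hdV).symm (realDiagonal_map L dW hdW).symm (cmEpsV L dV hdV ι₁) (cmEpsW L dV dW hdW ι₁)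
    (cmDV_ne_zero L dV hdV hdV0 ι₁) (cmDW_ne_zero L dV dW hdW hdW0 ι₁) (cmSignConv_ne_zero L dV ι₁) (cmCW_ne_zero L dV ι₁)
    (cm_htV L dV hdV hdV0 ι₁) (cm_htW L dV dW hdW hdW0 ι₁) (UnitaryGroup.complexConj_smul_infinitePlace L) v g'
  rw [archPairFrame_apply_eq_toUForm] at hE
  have h2 : ((archPairFrameEquiv L (IsCMField.complexConj L) N M (IsCMField.complexConj_ne_one L)
      (cmPlaceOver L) (cmPlaceOver_smul L) (cmPlaceOver_comap L) (cmRealVec L dV hdV) (cmRealVec L dW hdW)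
      (realDiagonal_map L dV hdV).symm (realDiagonal_map L dW hdW).symm (cmEpsV L dV hdV ι₁) (cmEpsW L dV dW hdW ι₁)
      (cmDV_ne_zero L dV hdV hdV0 ι₁) (cmDW_ne_zero L dV dW hdW hdW0 ι₁) (cmSignConv_ne_zero L dV ι₁) (cmCW_ne_zero L dV ι₁)
      (cm_htV L dV hdV hdV0 ι₁) (cm_htW L dV dW hdW hdW0 ι₁) v).symm g').1 = 1 :=
    (toUForm_bijective _ _ _ _).1 ((((Prod.ext_iff.1 hE).1).trans h1).trans (map_one _).symm)
  show (archPairSection L (IsCMField.complexConj L) N M (IsCMField.complexConj_ne_one L) (cmPlaceOver L) (cmPlaceOver_smul L)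
      (cmPlaceOver_comap L) (cmRealVec L dV hdV) (cmRealVec L dW hdW) (realDiagonal_map L dV hdV).symm
      (realDiagonal_map L dW hdW).symm (cmEpsV L dV hdV ι₁) (cmEpsW L dV dW hdW ι₁) (cmDV_ne_zero L dV hdV hdV0 ι₁)
      (cmDW_ne_zero L dV dW hdW hdW0 ι₁) (cmSignConv_ne_zero L dV ι₁) (cmCW_ne_zero L dV ι₁) (cm_htV L dV hdV hdV0 ι₁)
      (cm_htW L dV dW hdW hdW0 ι₁) (UnitaryGroup.complexConj_smul_infinitePlace L) v g').1 = 1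
  rw [archPairSection_apply, archPairSingle_apply, h2, map_one]

/-- hence its adelic image is `(1, (s_v (1, y)).2_𝔸)`. -/
theorem archProdHom_cmBlockSectionAt_one_left (y : UForm R' S') :
    archProdHom (↥(maximalRealSubfield L)) L (IsCMField.complexConj L) N M (Matrix.diagonal dV) (Matrix.diagonal dW)
        (cmBlockSectionAt L dV hdV hdV0 dW hdW hdW0 ι₁ v eP eQ eR eS (((1 : UForm P' Q'), y) : Ginf P' Q' R' S')) =
      (1, UnitaryGroup.archToAdelic (↥(maximalRealSubfield L)) L (IsCMField.complexConj L) M (Matrix.diagonal dW)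
        (cmBlockSectionAt L dV hdV hdV0 dW hdW hdW0 ι₁ v eP eQ eR eS (((1 : UForm P' Q'), y) : Ginf P' Q' R' S')).2) := by
  apply Prod.ext
  · change UnitaryGroup.archToAdelic (↥(maximalRealSubfield L)) L (IsCMField.complexConj L) N (Matrix.diagonal dV)
        (cmBlockSectionAt L dV hdV hdV0 dW hdW hdW0 ι₁ v eP eQ eR eS (((1 : UForm P' Q'), y) : Ginf P' Q' R' S')).1 = 1
    rw [fst_cmBlockSectionAt_one_left, map_one]
  · rfl

end Section

/-! ## §2 The boost curve on the `wm` input of record and the `smooth` field on block pure tensors -/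

section WInput

variable {L : CMField} {ι₁ : L →+* ℂ} (V : HermSpace3 L ι₁) (S : StubTree.SeesawDatum L)
variable
  (hGR : (cmSplittingDatum (L : Type) finProdFinEquiv (frameD V) (frameD_real V) (frameD_ne V) (dW S) (dW_real S) (dW_ne S)).CompatibleSplitting)
  (η : CMAdelic (L : Type) (frameD V) × CMAdelic (L : Type) (dW S) →* ℂˣ)
  (hηc : Continuous fun p => ((η p : ℂˣ) : ℂ))
  (Γ : Set (CMAdelic (L : Type) (frameD V) × CMAdelic (L : Type) (dW S)))
variable (v : {v : InfinitePlace ↥(maximalRealSubfield L) // v.IsReal})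
variable {P' Q' R' S' : Type} [Fintype P'] [DecidableEq P'] [Fintype Q'] [DecidableEq Q'] [Fintype R'] [DecidableEq R']
  [Fintype S'] [DecidableEq S']
variable (eP : PosIdx (cmXV (L : Type) (frameD V) (frameD_real V) ι₁ v) ≃ P')
  (eQ : NegIdx (cmXV (L : Type) (frameD V) (frameD_real V) ι₁ v) ≃ Q')
  (eR : PosIdx (cmXW (L : Type) (frameD V) (dW S) (dW_real S) ι₁ v) ≃ R')
  (eS : NegIdx (cmXW (L : Type) (frameD V) (dW S) (dW_real S) ι₁ v) ≃ S')

/-- **the `W`-side boost curve of the slot at `v`, in `U(W)(𝔸) = adelicUnitaryGroup L S.gramW`**: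
`t ↦ eW⁻¹ ((s_v (1, a_t)).2_𝔸)` (the `e b u` field of `HypSideW` at a `Σ₁₂` place). -/
def boostCurveW (r₀ : R') (s₀ : S') (t : ℝ) : ↥(Adelic.adelicUnitaryGroup L S.gramW) :=
  (cmAdelicEquiv (L : Type) 2 (Matrix.diagonal (dW S))).symm
    (UnitaryGroup.archToAdelic (↥(maximalRealSubfield L)) L (IsCMField.complexConj L) 2 (Matrix.diagonal (dW S))
      (cmBlockSectionAt (L : Type) (frameD V) (frameD_real V) (frameD_ne V) (dW S) (dW_real S) (dW_ne S) ι₁ v eP eQ eR eS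
        (((1 : UForm P' Q'), (hypV r₀ s₀ t : UForm R' S')) : Ginf P' Q' R' S')).2)

/-- `e_zero`: the curve passes through `1` at `t = 0`. -/
theorem boostCurveW_zero (r₀ : R') (s₀ : S') : boostCurveW V S v eP eQ eR eS r₀ s₀ 0 = 1 := by
  rw [boostCurveW, hypV_zero, Prod.mk_one_one, map_one, Prod.snd_one, map_one]
  exact (cmAdelicEquiv (L : Type) 2 (Matrix.diagonal (dW S))).symm.map_one

/-- **the pair-group element of the boost curve**: `(1, cmAdelicEquiv (boostCurveW t)) = archProdHom (s_v (1, a_t))` (so the pin's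
`ρ (1, eW (boostCurveW t))` IS the census's archimedean action at `(1, a_t)`). -/
theorem pair_cmAdelicEquiv_boostCurveW (r₀ : R') (s₀ : S') (t : ℝ) :
    ((1 : CMAdelic (L : Type) (frameD V)),
      (cmAdelicEquiv (L : Type) 2 (Matrix.diagonal (dW S)) (boostCurveW V S v eP eQ eR eS r₀ s₀ t) :
        CMAdelic (L : Type) (dW S))) =
      archProdHom (↥(maximalRealSubfield L)) L (IsCMField.complexConj L) 3 2 (Matrix.diagonal (frameD V))
        (Matrix.diagonal (dW S))
        (cmBlockSectionAt (L : Type) (frameD V) (frameD_real V) (frameD_ne V) (dW S) (dW_real S) (dW_ne S) ι₁ v eP eQ eR eS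
          (((1 : UForm P' Q'), (hypV r₀ s₀ t : UForm R' S')) : Ginf P' Q' R' S')) := by
  rw [archProdHom_cmBlockSectionAt_one_left, boostCurveW, ContinuousMulEquiv.apply_symm_apply]
  rfl

/-- the `W`-side sign profile `hW` of the (J-smooth) headline HOLDS for the plane `W = ⟨a₀⟩ ⊕ ⟨a₁⟩` (`M = 2`). -/
theorem dW_signs_of_ne (τ' : (L : Type) →+* ℂ) :
    (∃ j₀ : Fin 2, ∀ j, j ≠ j₀ → 0 < (τ' (dW S j)).re) ∨ ∀ j, (τ' (dW S j)).re < 0 :=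
  signs_fin_two fun j => re_apply_ne_zero_of_complexConj_eq (L : Type) τ' (dW_real S j) (dW_ne S j)

/-! ## §3 The `Θ`-topology slope along the boost curve, value currency -/

include hηc in
/-- **(J-smooth) ON A BLOCK PURE TENSOR, value currency**: for `ρ_η = cmPairRepTwist … hGR η` and any rational set `Γ`,
`s⁻¹ • (ρ_η (1, cmAdelicEquiv (boostCurveW s)) E(F_v⁻¹(Φ₁ ⊠ Φ₂) ⊗ f) − E(F_v⁻¹(Φ₁ ⊠ Φ₂) ⊗ f)) ⟶ E(F_v⁻¹((hypOpWGen Φ₁) ⊠ Φ₂) ⊗ f)`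
in Weil's `Θ`-initial topology of `repWeilThetaDatum L⁺ (Fin 6) ρ_η.toHomUnits Γ`, `s → 0`, `s ≠ 0`.  Hypotheses: the small datum
`hW₁ hc₁` of the slot and `h₁W` (`W` definite at `ι₁`); Weil's pair majorants discharged from `h₁W` and `HermSpace3`. -/
theorem tendsto_toThetaTop_boostCurveW_sub_div
    (h₁W : (∀ j, 0 < (ι₁ ((dW S) j)).re) ∨ ∀ j, (ι₁ ((dW S) j)).re < 0)
    {ω₁ : Representation ℂ (Ginf P' Q' R' S') (SchwartzMap (DPIdx P' Q' R' S' → ℝ) ℂ)}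
    (hW₁ : IsArchWeilDatum (ι𝕎 P' Q' R' S') ω₁) (hc₁ : ∀ u, Continuous (ω₁ u)) (r₀ : R') (s₀ : S')
    (Φ₁ : SchwartzMap (DPIdx P' Q' R' S' → ℝ) ℂ)
    (Φ₂ : SchwartzMap (Fin 6 × {w : {w : InfinitePlace ↥(maximalRealSubfield L) // w.IsReal} // w ≠ v} → ℝ) ℂ)
    (f : FinSB (↥(maximalRealSubfield L)) (Fin 6)) :
    Tendsto (fun s : ℝ => ((s : ℝ) : ℂ)⁻¹ •
        ((repWeilThetaDatum (↥(maximalRealSubfield L)) (Fin 6)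
              (cmPairRepTwist (L : Type) finProdFinEquiv (frameD V) (frameD_real V) (frameD_ne V) (dW S) (dW_real S) (dW_ne S)
                hGR η).toHomUnits Γ).toThetaTop
            (cmPairRepTwist (L : Type) finProdFinEquiv (frameD V) (frameD_real V) (frameD_ne V) (dW S) (dW_real S) (dW_ne S) hGR η
              ((1 : CMAdelic (L : Type) (frameD V)),
                (cmAdelicEquiv (L : Type) 2 (Matrix.diagonal (dW S)) (boostCurveW V S v eP eQ eR eS r₀ s₀ s) :
                  CMAdelic (L : Type) (dW S)))
              (piSchwartzBruhatEquiv (↥(maximalRealSubfield L)) (Fin 6)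
                ((cmBlockFrameAt (L : Type) finProdFinEquiv (frameD V) (frameD_real V) (frameD_ne V) (dW S) (dW_real S)
                  (dW_ne S) ι₁ v eP eQ eR eS).symm (tensorPi Φ₁ Φ₂) ⊗ₜ f))) -
          (repWeilThetaDatum (↥(maximalRealSubfield L)) (Fin 6)
              (cmPairRepTwist (L : Type) finProdFinEquiv (frameD V) (frameD_real V) (frameD_ne V) (dW S) (dW_real S) (dW_ne S)
                hGR η).toHomUnits Γ).toThetaTop
            (piSchwartzBruhatEquiv (↥(maximalRealSubfield L)) (Fin 6)
              ((cmBlockFrameAt (L : Type) finProdFinEquiv (frameD V) (frameD_real V) (frameD_ne V) (dW S) (dW_real S)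
                (dW_ne S) ι₁ v eP eQ eR eS).symm (tensorPi Φ₁ Φ₂) ⊗ₜ f))))
      (𝓝[≠] 0)
      (𝓝 ((repWeilThetaDatum (↥(maximalRealSubfield L)) (Fin 6)
              (cmPairRepTwist (L : Type) finProdFinEquiv (frameD V) (frameD_real V) (frameD_ne V) (dW S) (dW_real S) (dW_ne S)
                hGR η).toHomUnits Γ).toThetaTop
        (piSchwartzBruhatEquiv (↥(maximalRealSubfield L)) (Fin 6)
          ((cmBlockFrameAt (L : Type) finProdFinEquiv (frameD V) (frameD_real V) (frameD_ne V) (dW S) (dW_real S)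
            (dW_ne S) ι₁ v eP eQ eR eS).symm (tensorPi (hypOpWGen P' Q' r₀ s₀ Φ₁) Φ₂) ⊗ₜ f)))) := by
  have h := tendsto_toThetaTop_cmPairRepTwist_one_hypV_sub_div' (L : Type) finProdFinEquiv (frameD V) (frameD_real V)
    (frameD_ne V) (dW S) (dW_real S) (dW_ne S) hGR ι₁ v eP eQ eR eS (frameD_sign_ι₁' V) h₁W (frameD_sign_of_ne V)
    (fun τ' _ => dW_signs_of_ne S τ') η Γ
    (hasThetaMajorants_cmPairRepTwist (L : Type) finProdFinEquiv (frameD V) (frameD_real V) (frameD_ne V) (dW S) (dW_real S)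
      (dW_ne S) hGR η
      (hasThetaMajorants_cmPairSplitting_of_signs_two (L : Type) finProdFinEquiv (frameD V) (frameD_real V) (frameD_ne V) (dW S)
        (dW_real S) (dW_ne S) ι₁ hGR (frameD_sign_ι₁' V) h₁W (frameD_sign_of_ne V)) hηc)
    hW₁ hc₁ r₀ s₀ Φ₁ Φ₂ f
  simp only [pair_cmAdelicEquiv_boostCurveW]
  exact h

end WInput

end HodgeCM.Model.HypCensus

end
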